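import Summits.AtomisticToContinuum.Crystallization.Theorems.GappedShellCensusCleanLimitsHaveWindowsCleanChartTSteps1
import Summits.AtomisticToContinuum.Crystallization.Theorems.GappedShellCensusCleanLimitsHaveWindowsCleanChartTSteps6
import Summits.AtomisticToContinuum.Crystallization.Theorems.GappedShellCensusCleanLimitsHaveWindowsCleanChartTLower
import Summits.AtomisticToContinuum.Crystallization.Theorems.GappedShellCensusCleanLimitsHaveWindowsCleanChartTVinv
import Summits.AtomisticToContinuum.Crystallization.Theorems.GappedShellCensusCleanLimitsHaveWindowsCleanChartTAttach1
import Summits.AtomisticToContinuum.Crystallization.Theorems.PalmUnimodularRigidityShellsToBarlowChartTransportGlobalD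

/-!
# `CleanLimitsHaveWindows` (stmt-AtomisticToContinuum-15932), line `Sketch` — stub K1 (`stub_cleanChart`):
# the transport development re-run on CLEAN charts — copy of `PalmUnimodularRigidityShellsToBarlowChartTransportGlobalD`

This file is a mechanical copy of `Theorems/PalmUnimodularRigidityShellsToBarlowChartTransportGlobalD.lean` (crux `ShellsToBarlowChart`,
route `PalmUnimodularRigidity`; original title: Line `develop-the-model-growth-descent` (crux `ShellsToBarlowChart`, stmt-AtomisticToContinuum-9227): STAR and LINK from the label table of a site)
in which the chart hypothesis `hch : ∀ z ∈ S, IsZChart S z (ac z) (Pc z) (Ac z) (nb z)` (integer charts with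
`1 %` closeness) is replaced by the CLEAN-CHART hypothesis: at every site a labelling of the bonded neighbours
by `fcc3Int`/`hcpInt`, bijective, with bonds among neighbours = label pairs at squared distance `18`, together
with the TRANSFER property across every bond (proved for clean sets at matching radius `1/5` in
`…CleanChartTransfer`).  The original development uses its metric hypothesis only through the transfer
lemma, so all proofs go through verbatim; declarations live in the sub-namespace `….Clean` and shadow the
originals, the `hch`-free lemmas of the original file are reused, not restated.  All `[folklore]`.
-/

noncomputable section

namespace Summit.AtomisticToContinuum.Crystallization.Theorems.PalmUnimodularRigidityShellsToBarlowChart.Clean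

open Literature.Geometry.DiscreteGeometry Literature.MathematicalPhysics.StatisticalMechanics
open Summit.AtomisticToContinuum.Crystallization.Theorems.ShellsToBarlowChartNegative

variable {S : Set (EuclideanSpace ℝ (Fin 3))} {Pc : (EuclideanSpace ℝ (Fin 3)) → Finset (Fin 3 → ℤ)}
  {nb : (EuclideanSpace ℝ (Fin 3)) → (Fin 3 → ℤ) → (EuclideanSpace ℝ (Fin 3))}

/-- **STAR and LINK from a label table.**  If the twelve link labels `L y`, `y ∈ linkOffsets`,
are exactly the pattern of `x` and their touching table is `linkAdj`, then `y ↦ nb x (L y)` is a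
bijection onto the bonded neighbours of `x`, faithful on links. [folklore] -/
theorem star_core (hch : ((∀ z ∈ S, (Pc z = fcc3Int ∨ Pc z = hcpInt) ∧ Set.BijOn (nb z) (↑(Pc z) : Set (Fin 3 → ℤ)) {y | y ∈ S ∧ (0 < dist z y ∧ dist z y ≤ 28 / 25)} ∧ (∀ t ∈ Pc z, ∀ t' ∈ Pc z, ((0 < dist (nb z t) (nb z t') ∧ dist (nb z t) (nb z t') ≤ 28 / 25) ↔ sqNormInt (t - t') = 18))) ∧ (∀ x ∈ S, ∀ y ∈ S, (0 < dist x y ∧ dist x y ≤ 28 / 25) → ∀ t ∈ Pc x, ∀ t' ∈ Pc x, ∀ u ∈ Pc y, ∀ u' ∈ Pc y, nb y u = nb x t → nb y u' = nb x t' → sqNormInt (u - u') = sqNormInt (t - t')))) {x : (EuclideanSpace ℝ (Fin 3))} (hx : x ∈ S)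
    {σm σp : ℤ} (L : ℤ × ℤ × ℤ → (Fin 3 → ℤ)) (himg : (linkOffsets σm σp).image L = Pc x)
    (hrows : ∀ y ∈ linkOffsets σm σp, ∀ y' ∈ linkOffsets σm σp,
      (sqNormInt (L y - L y') = 18 ↔ linkAdj σm σp y y'))
    (hcard : (linkOffsets σm σp).card = 12) (hcardP : (Pc x).card = 12)
    (Φ : ℤ × ℤ × ℤ → (EuclideanSpace ℝ (Fin 3))) (hΦ : ∀ y ∈ linkOffsets σm σp, Φ y = nb x (L y)) :
    Set.BijOn Φ (↑(linkOffsets σm σp) : Set (ℤ × ℤ × ℤ)) {z | z ∈ S ∧ (0 < dist x z ∧ dist x z ≤ 28 / 25)} ∧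
    ∀ y ∈ linkOffsets σm σp, ∀ y' ∈ linkOffsets σm σp,
      ((0 < dist (Φ y) (Φ y') ∧ dist (Φ y) (Φ y') ≤ 28 / 25) ↔ linkAdj σm σp y y') := by
  have hLP : ∀ y ∈ linkOffsets σm σp, L y ∈ Pc x := fun y hy => by
    rw [← himg]; exact Finset.mem_image_of_mem L hy
  have hinjL : Set.InjOn L ↑(linkOffsets σm σp) :=
    Finset.card_image_iff.1 (by rw [himg, hcardP, hcard])
  refine ⟨⟨fun y hy => ?_, fun y hy y' hy' heq => ?_, fun z hz => ?_⟩, fun y hy y' hy' => ?_⟩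
  · rw [Finset.mem_coe] at hy
    rw [hΦ y hy]; exact nb_mem hch hx (hLP y hy)
  · rw [Finset.mem_coe] at hy hy'
    rw [hΦ y hy, hΦ y' hy'] at heq
    exact hinjL hy hy' (nb_inj hch hx (hLP y hy) (hLP y' hy') heq)
  · obtain ⟨hzS, hb⟩ := hz
    obtain ⟨t, ht, htz⟩ := (hch.1 x hx).2.1.surjOn ⟨hzS, hb⟩
    have ht' : t ∈ (linkOffsets σm σp).image L := by rw [himg]; exact ht
    obtain ⟨y, hy, hLy⟩ := Finset.mem_image.1 ht'
    exact ⟨y, hy, by rw [hΦ y hy, hLy, htz]⟩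
  · rw [hΦ y hy, hΦ y' hy', bond_nb_iff hch hx (hLP y hy) (hLP y' hy')]
    exact hrows y hy y' hy'

/-- **The label table of an FCC site of parity `+1`**: letter below `+1`, lower apex `−c`, the
STAR image and the LINK rows. [folklore] -/
theorem table_fcc_p (hch : ((∀ z ∈ S, (Pc z = fcc3Int ∨ Pc z = hcpInt) ∧ Set.BijOn (nb z) (↑(Pc z) : Set (Fin 3 → ℤ)) {y | y ∈ S ∧ (0 < dist z y ∧ dist z y ≤ 28 / 25)} ∧ (∀ t ∈ Pc z, ∀ t' ∈ Pc z, ((0 < dist (nb z t) (nb z t') ∧ dist (nb z t) (nb z t') ≤ 28 / 25) ↔ sqNormInt (t - t') = 18))) ∧ (∀ x ∈ S, ∀ y ∈ S, (0 < dist x y ∧ dist x y ≤ 28 / 25) → ∀ t ∈ Pc x, ∀ t' ∈ Pc x, ∀ u ∈ Pc y, ∀ u' ∈ Pc y, nb y u = nb x t → nb y u' = nb x t' → sqNormInt (u - u') = sqNormInt (t - t')))) {x : (EuclideanSpace ℝ (Fin 3))} (hx : x ∈ S)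
    {t₁ t₂ : Fin 3 → ℤ} {U : Finset (Fin 3 → ℤ)} (hU : IsFrame (Pc x) t₁ t₂ U) (hPx : Pc x = fcc3Int)
    (hpar : frameParity t₁ t₂ U = 1) :
    lowerParity t₁ t₂ (lowerCap (Pc x) t₁ t₂ U) = 1 ∧
    apexOf t₁ t₂ (lowerCap (Pc x) t₁ t₂ U) = -apexOf t₁ t₂ U ∧
    (linkOffsets 1 1).image (fun y : ℤ × ℤ × ℤ =>
      ((if y.1 = 1 then apexOf t₁ t₂ U else if y.1 = -1 then (-apexOf t₁ t₂ U) else 0) - y.2.1 • t₁ - y.2.2 • t₂)) = Pc x ∧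
    ∀ y ∈ linkOffsets 1 1, ∀ y' ∈ linkOffsets 1 1,
      (sqNormInt (((if y.1 = 1 then apexOf t₁ t₂ U else if y.1 = -1 then (-apexOf t₁ t₂ U) else 0) - y.2.1 • t₁ - y.2.2 • t₂) -
        ((if y'.1 = 1 then apexOf t₁ t₂ U else if y'.1 = -1 then (-apexOf t₁ t₂ U) else 0) - y'.2.1 • t₁ - y'.2.2 • t₂)) = 18 ↔
        linkAdj 1 1 y y') := by
  have hP := pattern_cases hch hx
  obtain ⟨h12, hhex, hUP, -, -⟩ := id hU
  obtain ⟨hcU, hcP, hcoff, hc1, hc2, hE⟩ := even_form_of_parity hP hU hpar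
  set c := apexOf t₁ t₂ U with hc_def
  have ht₁ : t₁ ∈ Pc x := hhex (mem_hexLabels_iff.2 (Or.inl rfl))
  have ht₂ : t₂ ∈ Pc x := hhex (mem_hexLabels_iff.2 (Or.inr (Or.inl rfl)))
  have ht₁' : t₁ ∈ fcc3Int := by rw [← hPx]; exact ht₁
  have ht₂' : t₂ ∈ fcc3Int := by rw [← hPx]; exact ht₂
  have hcP' : c ∈ fcc3Int := by rw [← hPx]; exact hcP
  have hc1' : c - t₁ ∈ fcc3Int := by rw [← hPx]; exact hc1
  have hc2' : c - t₂ ∈ fcc3Int := by rw [← hPx]; exact hc2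
  have hhex' : hexLabels t₁ t₂ ⊆ fcc3Int := by rw [← hPx]; exact hhex
  have hL : lowerCap (Pc x) t₁ t₂ U = {-c, -c + t₁, -c + t₂} := by
    rw [hE, hPx]; exact lowerCap_evenCap_fcc3Int t₁ ht₁' t₂ ht₂' c hcP' h12 hhex' hcoff hc1' hc2'
  refine ⟨by rw [hL]; exact lowerParity_pos t₁ t₂ (-c), ?_, ?_, ?_⟩
  · refine apexOf_eq_of_form hP (isFrame_lowerCap hP hU) (by rw [hL]; simp) (Or.inr (by rw [hL]))
  · rw [hPx]; exact star_image_fcc_p t₁ ht₁' t₂ ht₂' c hcP' h12 hhex' hcoff hc1' hc2'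
  · intro y hy y' hy'
    rw [linkOffsets_eq_fcc_p] at hy
    simp only [Finset.mem_insert, Finset.mem_singleton] at hy
    rcases hy with rfl | rfl | rfl | rfl | rfl | rfl | rfl | rfl | rfl | rfl | rfl | rfl
    exacts [linkRow_fcc_p_0 y' hy' t₁ ht₁' t₂ ht₂' _ hcP' h12 hhex' hcoff hc1' hc2', linkRow_fcc_p_1 y' hy' t₁ ht₁' t₂ ht₂' _ hcP' h12 hhex' hcoff hc1' hc2', linkRow_fcc_p_2 y' hy' t₁ ht₁' t₂ ht₂' _ hcP' h12 hhex' hcoff hc1' hc2', linkRow_fcc_p_3 y' hy' t₁ ht₁' t₂ ht₂' _ hcP' h12 hhex' hcoff hc1' hc2', linkRow_fcc_p_4 y' hy' t₁ ht₁' t₂ ht₂' _ hcP' h12 hhex' hcoff hc1' hc2', linkRow_fcc_p_5 y' hy' t₁ ht₁' t₂ ht₂' _ hcP' h12 hhex' hcoff hc1' hc2', linkRow_fcc_p_6 y' hy' t₁ ht₁' t₂ ht₂' _ hcP' h12 hhex' hcoff hc1' hc2', linkRow_fcc_p_7 y' hy' t₁ ht₁' t₂ ht₂' _ hcP' h12 hhex'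 hcoff hc1' hc2', linkRow_fcc_p_8 y' hy' t₁ ht₁' t₂ ht₂' _ hcP' h12 hhex' hcoff hc1' hc2', linkRow_fcc_p_9 y' hy' t₁ ht₁' t₂ ht₂' _ hcP' h12 hhex' hcoff hc1' hc2', linkRow_fcc_p_10 y' hy' t₁ ht₁' t₂ ht₂' _ hcP' h12 hhex' hcoff hc1' hc2', linkRow_fcc_p_11 y' hy' t₁ ht₁' t₂ ht₂' _ hcP' h12 hhex' hcoff hc1' hc2']

/-- **The label table of an FCC site of parity `−1`**: letter below `−1`, lower apex `−c`, the
STAR image and the LINK rows. [folklore] -/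
theorem table_fcc_m (hch : ((∀ z ∈ S, (Pc z = fcc3Int ∨ Pc z = hcpInt) ∧ Set.BijOn (nb z) (↑(Pc z) : Set (Fin 3 → ℤ)) {y | y ∈ S ∧ (0 < dist z y ∧ dist z y ≤ 28 / 25)} ∧ (∀ t ∈ Pc z, ∀ t' ∈ Pc z, ((0 < dist (nb z t) (nb z t') ∧ dist (nb z t) (nb z t') ≤ 28 / 25) ↔ sqNormInt (t - t') = 18))) ∧ (∀ x ∈ S, ∀ y ∈ S, (0 < dist x y ∧ dist x y ≤ 28 / 25) → ∀ t ∈ Pc x, ∀ t' ∈ Pc x, ∀ u ∈ Pc y, ∀ u' ∈ Pc y, nb y u = nb x t → nb y u' = nb x t' → sqNormInt (u - u') = sqNormInt (t - t')))) {x : (EuclideanSpace ℝ (Fin 3))} (hx : x ∈ S)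
    {t₁ t₂ : Fin 3 → ℤ} {U : Finset (Fin 3 → ℤ)} (hU : IsFrame (Pc x) t₁ t₂ U) (hPx : Pc x = fcc3Int)
    (hpar : frameParity t₁ t₂ U = -1) :
    lowerParity t₁ t₂ (lowerCap (Pc x) t₁ t₂ U) = -1 ∧
    apexOf t₁ t₂ (lowerCap (Pc x) t₁ t₂ U) = (-apexOf t₁ t₂ U) ∧
    (linkOffsets (-1) (-1)).image (fun y : ℤ × ℤ × ℤ =>
      ((if y.1 = 1 then apexOf t₁ t₂ U else if y.1 = -1 then (-apexOf t₁ t₂ U) else 0) - y.2.1 • t₁ - y.2.2 • t₂)) = Pc x ∧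
    ∀ y ∈ linkOffsets (-1) (-1), ∀ y' ∈ linkOffsets (-1) (-1),
      (sqNormInt (((if y.1 = 1 then apexOf t₁ t₂ U else if y.1 = -1 then (-apexOf t₁ t₂ U) else 0) - y.2.1 • t₁ - y.2.2 • t₂) -
        ((if y'.1 = 1 then apexOf t₁ t₂ U else if y'.1 = -1 then (-apexOf t₁ t₂ U) else 0) - y'.2.1 • t₁ - y'.2.2 • t₂)) = 18 ↔
        linkAdj (-1) (-1) y y') := by
  have hP := pattern_cases hch hx
  obtain ⟨h12, hhex, hUP, -, -⟩ := id hU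
  obtain ⟨hcU, hcP, hcoff, hc1, hc2, hE⟩ := odd_form_of_parity hP hU hpar
  set c := apexOf t₁ t₂ U with hc_def
  have ht₁ : t₁ ∈ Pc x := hhex (mem_hexLabels_iff.2 (Or.inl rfl))
  have ht₂ : t₂ ∈ Pc x := hhex (mem_hexLabels_iff.2 (Or.inr (Or.inl rfl)))
  have ht₁' : t₁ ∈ fcc3Int := by rw [← hPx]; exact ht₁
  have ht₂' : t₂ ∈ fcc3Int := by rw [← hPx]; exact ht₂
  have hcP' : c ∈ fcc3Int := by rw [← hPx]; exact hcP
  have hc1' : c + t₁ ∈ fcc3Int := by rw [← hPx]; exact hc1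
  have hc2' : c + t₂ ∈ fcc3Int := by rw [← hPx]; exact hc2
  have hhex' : hexLabels t₁ t₂ ⊆ fcc3Int := by rw [← hPx]; exact hhex
  have hL : lowerCap (Pc x) t₁ t₂ U = {-c, -c - t₁, -c - t₂} := by
    rw [hE, hPx]; exact lowerCap_oddCap_fcc3Int t₁ ht₁' t₂ ht₂' c hcP' h12 hhex' hcoff hc1' hc2'
  refine ⟨by rw [hPx] at hU ⊢; rw [hPx] at hL; exact lowerParity_of_even_form (Or.inl rfl) hU hL, ?_, ?_, ?_⟩
  · refine apexOf_eq_of_form hP (isFrame_lowerCap hP hU) (by rw [hL]; simp) (Or.inl (by rw [hL]))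
  · rw [hPx]; exact star_image_fcc_m t₁ ht₁' t₂ ht₂' c hcP' h12 hhex' hcoff hc1' hc2'
  · intro y hy y' hy'
    rw [linkOffsets_eq_fcc_m] at hy
    simp only [Finset.mem_insert, Finset.mem_singleton] at hy
    rcases hy with rfl | rfl | rfl | rfl | rfl | rfl | rfl | rfl | rfl | rfl | rfl | rfl
    exacts [linkRow_fcc_m_0 y' hy' t₁ ht₁' t₂ ht₂' _ hcP' h12 hhex' hcoff hc1' hc2', linkRow_fcc_m_1 y' hy' t₁ ht₁' t₂ ht₂' _ hcP' h12 hhex' hcoff hc1' hc2', linkRow_fcc_m_2 y' hy' t₁ ht₁' t₂ ht₂' _ hcP' h12 hhex' hcoff hc1' hc2', linkRow_fcc_m_3 y' hy' t₁ ht₁' t₂ ht₂' _ hcP' h12 hhex' hcoff hc1' hc2', linkRow_fcc_m_4 y' hy' t₁ ht₁' t₂ ht₂' _ hcP' h12 hhex' hcoff hc1' hc2', linkRow_fcc_m_5 y' hy' t₁ ht₁' t₂ ht₂' _ hcP' h12 hhex' hcoff hc1' hc2', linkRow_fcc_m_6 y' hy' t₁ ht₁' t₂ ht₂' _ hcP'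 h12 hhex' hcoff hc1' hc2', linkRow_fcc_m_7 y' hy' t₁ ht₁' t₂ ht₂' _ hcP' h12 hhex' hcoff hc1' hc2', linkRow_fcc_m_8 y' hy' t₁ ht₁' t₂ ht₂' _ hcP' h12 hhex' hcoff hc1' hc2', linkRow_fcc_m_9 y' hy' t₁ ht₁' t₂ ht₂' _ hcP' h12 hhex' hcoff hc1' hc2', linkRow_fcc_m_10 y' hy' t₁ ht₁' t₂ ht₂' _ hcP' h12 hhex' hcoff hc1' hc2', linkRow_fcc_m_11 y' hy' t₁ ht₁' t₂ ht₂' _ hcP' h12 hhex' hcoff hc1' hc2']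

/-- **The label table of an HCP site of parity `+1`**: letter below `−1`, lower apex `c − (Σc/6·4)(1,1,1)`, the
STAR image and the LINK rows. [folklore] -/
theorem table_hcp_p (hch : ((∀ z ∈ S, (Pc z = fcc3Int ∨ Pc z = hcpInt) ∧ Set.BijOn (nb z) (↑(Pc z) : Set (Fin 3 → ℤ)) {y | y ∈ S ∧ (0 < dist z y ∧ dist z y ≤ 28 / 25)} ∧ (∀ t ∈ Pc z, ∀ t' ∈ Pc z, ((0 < dist (nb z t) (nb z t') ∧ dist (nb z t) (nb z t') ≤ 28 / 25) ↔ sqNormInt (t - t') = 18))) ∧ (∀ x ∈ S, ∀ y ∈ S, (0 < dist x y ∧ dist x y ≤ 28 / 25) → ∀ t ∈ Pc x, ∀ t' ∈ Pc x, ∀ u ∈ Pc y, ∀ u' ∈ Pc y, nb y u = nb x t → nb y u' = nb x t' → sqNormInt (u - u') = sqNormInt (t - t')))) {x : (EuclideanSpace ℝ (Fin 3))} (hx : x ∈ S)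
    {t₁ t₂ : Fin 3 → ℤ} {U : Finset (Fin 3 → ℤ)} (hU : IsFrame (Pc x) t₁ t₂ U) (hPx : Pc x = hcpInt)
    (hpar : frameParity t₁ t₂ U = 1) :
    lowerParity t₁ t₂ (lowerCap (Pc x) t₁ t₂ U) = -1 ∧
    apexOf t₁ t₂ (lowerCap (Pc x) t₁ t₂ U) = (apexOf t₁ t₂ U - ((apexOf t₁ t₂ U 0 + apexOf t₁ t₂ U 1 + apexOf t₁ t₂ U 2) / 6 * 4) • (1 : Fin 3 → ℤ)) ∧
    (linkOffsets (-1) 1).image (fun y : ℤ × ℤ × ℤ =>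
      ((if y.1 = 1 then apexOf t₁ t₂ U else if y.1 = -1 then (apexOf t₁ t₂ U - ((apexOf t₁ t₂ U 0 + apexOf t₁ t₂ U 1 + apexOf t₁ t₂ U 2) / 6 * 4) • (1 : Fin 3 → ℤ)) else 0) - y.2.1 • t₁ - y.2.2 • t₂)) = Pc x ∧
    ∀ y ∈ linkOffsets (-1) 1, ∀ y' ∈ linkOffsets (-1) 1,
      (sqNormInt (((if y.1 = 1 then apexOf t₁ t₂ U else if y.1 = -1 then (apexOf t₁ t₂ U - ((apexOf t₁ t₂ U 0 + apexOf t₁ t₂ U 1 + apexOf t₁ t₂ U 2) / 6 * 4) • (1 : Fin 3 → ℤ)) else 0) - y.2.1 • t₁ - y.2.2 • t₂) -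
        ((if y'.1 = 1 then apexOf t₁ t₂ U else if y'.1 = -1 then (apexOf t₁ t₂ U - ((apexOf t₁ t₂ U 0 + apexOf t₁ t₂ U 1 + apexOf t₁ t₂ U 2) / 6 * 4) • (1 : Fin 3 → ℤ)) else 0) - y'.2.1 • t₁ - y'.2.2 • t₂)) = 18 ↔
        linkAdj (-1) 1 y y') := by
  have hP := pattern_cases hch hx
  obtain ⟨h12, hhex, hUP, -, -⟩ := id hU
  obtain ⟨hcU, hcP, hcoff, hc1, hc2, hE⟩ := even_form_of_parity hP hU hpar
  set c := apexOf t₁ t₂ U with hc_def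
  have ht₁ : t₁ ∈ Pc x := hhex (mem_hexLabels_iff.2 (Or.inl rfl))
  have ht₂ : t₂ ∈ Pc x := hhex (mem_hexLabels_iff.2 (Or.inr (Or.inl rfl)))
  have ht₁' : t₁ ∈ hcpInt := by rw [← hPx]; exact ht₁
  have ht₂' : t₂ ∈ hcpInt := by rw [← hPx]; exact ht₂
  have hcP' : c ∈ hcpInt := by rw [← hPx]; exact hcP
  have hc1' : c - t₁ ∈ hcpInt := by rw [← hPx]; exact hc1
  have hc2' : c - t₂ ∈ hcpInt := by rw [← hPx]; exact hc2
  have hhex' : hexLabels t₁ t₂ ⊆ hcpInt := by rw [← hPx]; exact hhex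
  have hL : lowerCap (Pc x) t₁ t₂ U = {(c - ((c 0 + c 1 + c 2) / 6 * 4) • (1 : Fin 3 → ℤ)), (c - ((c 0 + c 1 + c 2) / 6 * 4) • (1 : Fin 3 → ℤ)) - t₁, (c - ((c 0 + c 1 + c 2) / 6 * 4) • (1 : Fin 3 → ℤ)) - t₂} := by
    rw [hE, hPx]; exact lowerCap_formula_hcp_p t₁ ht₁' t₂ ht₂' c hcP' h12 hhex' hcoff hc1' hc2'
  refine ⟨by rw [hPx] at hU ⊢; rw [hPx] at hL; exact lowerParity_of_even_form (Or.inr rfl) hU hL, ?_, ?_, ?_⟩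
  · refine apexOf_eq_of_form hP (isFrame_lowerCap hP hU) (by rw [hL]; simp) (Or.inl (by rw [hL]))
  · rw [hPx]; exact star_image_hcp_p t₁ ht₁' t₂ ht₂' c hcP' h12 hhex' hcoff hc1' hc2'
  · intro y hy y' hy'
    rw [linkOffsets_eq_hcp_p] at hy
    simp only [Finset.mem_insert, Finset.mem_singleton] at hy
    rcases hy with rfl | rfl | rfl | rfl | rfl | rfl | rfl | rfl | rfl | rfl | rfl | rfl
    exacts [linkRow_hcp_p_0 y' hy' t₁ ht₁' t₂ ht₂' _ hcP' h12 hhex' hcoff hc1' hc2', linkRow_hcp_p_1 y' hy' t₁ ht₁' t₂ ht₂' _ hcP' h12 hhex' hcoff hc1' hc2', linkRow_hcp_p_2 y' hy' t₁ ht₁' t₂ ht₂' _ hcP' h12 hhex' hcoff hc1' hc2', linkRow_hcp_p_3 y' hy' t₁ ht₁' t₂ ht₂' _ hcP' h12 hhex' hcoff hc1' hc2', linkRow_hcp_p_4 y' hy' t₁ ht₁' t₂ ht₂' _ hcP' h12 hhex' hcoff hc1' hc2', linkRow_hcp_p_5 y' hy' t₁ ht₁' t₂ ht₂' _ hcP'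 h12 hhex' hcoff hc1' hc2', linkRow_hcp_p_6 y' hy' t₁ ht₁' t₂ ht₂' _ hcP' h12 hhex' hcoff hc1' hc2', linkRow_hcp_p_7 y' hy' t₁ ht₁' t₂ ht₂' _ hcP' h12 hhex' hcoff hc1' hc2', linkRow_hcp_p_8 y' hy' t₁ ht₁' t₂ ht₂' _ hcP' h12 hhex' hcoff hc1' hc2', linkRow_hcp_p_9 y' hy' t₁ ht₁' t₂ ht₂' _ hcP' h12 hhex' hcoff hc1' hc2', linkRow_hcp_p_10 y' hy' t₁ ht₁' t₂ ht₂' _ hcP' h12 hhex' hcoff hc1' hc2', linkRow_hcp_p_11 y' hy' t₁ ht₁' t₂ ht₂' _ hcP' h12 hhex' hcoff hc1' hc2']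

/-- **The label table of an HCP site of parity `−1`**: letter below `+1`, lower apex `c − (Σc/6·4)(1,1,1)`, the
STAR image and the LINK rows. [folklore] -/
theorem table_hcp_m (hch : ((∀ z ∈ S, (Pc z = fcc3Int ∨ Pc z = hcpInt) ∧ Set.BijOn (nb z) (↑(Pc z) : Set (Fin 3 → ℤ)) {y | y ∈ S ∧ (0 < dist z y ∧ dist z y ≤ 28 / 25)} ∧ (∀ t ∈ Pc z, ∀ t' ∈ Pc z, ((0 < dist (nb z t) (nb z t') ∧ dist (nb z t) (nb z t') ≤ 28 / 25) ↔ sqNormInt (t - t') = 18))) ∧ (∀ x ∈ S, ∀ y ∈ S, (0 < dist x y ∧ dist x y ≤ 28 / 25) → ∀ t ∈ Pc x, ∀ t' ∈ Pc x, ∀ u ∈ Pc y, ∀ u' ∈ Pc y, nb y u = nb x t → nb y u' = nb x t' → sqNormInt (u - u') = sqNormInt (t - t')))) {x : (EuclideanSpace ℝ (Fin 3))} (hx : x ∈ S)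
    {t₁ t₂ : Fin 3 → ℤ} {U : Finset (Fin 3 → ℤ)} (hU : IsFrame (Pc x) t₁ t₂ U) (hPx : Pc x = hcpInt)
    (hpar : frameParity t₁ t₂ U = -1) :
    lowerParity t₁ t₂ (lowerCap (Pc x) t₁ t₂ U) = 1 ∧
    apexOf t₁ t₂ (lowerCap (Pc x) t₁ t₂ U) = (apexOf t₁ t₂ U - ((apexOf t₁ t₂ U 0 + apexOf t₁ t₂ U 1 + apexOf t₁ t₂ U 2) / 6 * 4) • (1 : Fin 3 → ℤ)) ∧
    (linkOffsets 1 (-1)).image (fun y : ℤ × ℤ × ℤ =>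
      ((if y.1 = 1 then apexOf t₁ t₂ U else if y.1 = -1 then (apexOf t₁ t₂ U - ((apexOf t₁ t₂ U 0 + apexOf t₁ t₂ U 1 + apexOf t₁ t₂ U 2) / 6 * 4) • (1 : Fin 3 → ℤ)) else 0) - y.2.1 • t₁ - y.2.2 • t₂)) = Pc x ∧
    ∀ y ∈ linkOffsets 1 (-1), ∀ y' ∈ linkOffsets 1 (-1),
      (sqNormInt (((if y.1 = 1 then apexOf t₁ t₂ U else if y.1 = -1 then (apexOf t₁ t₂ U - ((apexOf t₁ t₂ U 0 + apexOf t₁ t₂ U 1 + apexOf t₁ t₂ U 2) / 6 * 4) • (1 : Fin 3 → ℤ)) else 0) - y.2.1 • t₁ - y.2.2 • t₂) -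
        ((if y'.1 = 1 then apexOf t₁ t₂ U else if y'.1 = -1 then (apexOf t₁ t₂ U - ((apexOf t₁ t₂ U 0 + apexOf t₁ t₂ U 1 + apexOf t₁ t₂ U 2) / 6 * 4) • (1 : Fin 3 → ℤ)) else 0) - y'.2.1 • t₁ - y'.2.2 • t₂)) = 18 ↔
        linkAdj 1 (-1) y y') := by
  have hP := pattern_cases hch hx
  obtain ⟨h12, hhex, hUP, -, -⟩ := id hU
  obtain ⟨hcU, hcP, hcoff, hc1, hc2, hE⟩ := odd_form_of_parity hP hU hpar
  set c := apexOf t₁ t₂ U with hc_def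
  have ht₁ : t₁ ∈ Pc x := hhex (mem_hexLabels_iff.2 (Or.inl rfl))
  have ht₂ : t₂ ∈ Pc x := hhex (mem_hexLabels_iff.2 (Or.inr (Or.inl rfl)))
  have ht₁' : t₁ ∈ hcpInt := by rw [← hPx]; exact ht₁
  have ht₂' : t₂ ∈ hcpInt := by rw [← hPx]; exact ht₂
  have hcP' : c ∈ hcpInt := by rw [← hPx]; exact hcP
  have hc1' : c + t₁ ∈ hcpInt := by rw [← hPx]; exact hc1
  have hc2' : c + t₂ ∈ hcpInt := by rw [← hPx]; exact hc2
  have hhex' : hexLabels t₁ t₂ ⊆ hcpInt := by rw [← hPx]; exact hhex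
  have hL : lowerCap (Pc x) t₁ t₂ U = {(c - ((c 0 + c 1 + c 2) / 6 * 4) • (1 : Fin 3 → ℤ)), (c - ((c 0 + c 1 + c 2) / 6 * 4) • (1 : Fin 3 → ℤ)) + t₁, (c - ((c 0 + c 1 + c 2) / 6 * 4) • (1 : Fin 3 → ℤ)) + t₂} := by
    rw [hE, hPx]; exact lowerCap_formula_hcp_m t₁ ht₁' t₂ ht₂' c hcP' h12 hhex' hcoff hc1' hc2'
  refine ⟨by rw [hL]; exact lowerParity_pos t₁ t₂ ((c - ((c 0 + c 1 + c 2) / 6 * 4) • (1 : Fin 3 → ℤ))), ?_, ?_, ?_⟩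
  · refine apexOf_eq_of_form hP (isFrame_lowerCap hP hU) (by rw [hL]; simp) (Or.inr (by rw [hL]))
  · rw [hPx]; exact star_image_hcp_m t₁ ht₁' t₂ ht₂' c hcP' h12 hhex' hcoff hc1' hc2'
  · intro y hy y' hy'
    rw [linkOffsets_eq_hcp_m] at hy
    simp only [Finset.mem_insert, Finset.mem_singleton] at hy
    rcases hy with rfl | rfl | rfl | rfl | rfl | rfl | rfl | rfl | rfl | rfl | rfl | rfl
    exacts [linkRow_hcp_m_0 y' hy' t₁ ht₁' t₂ ht₂' _ hcP' h12 hhex' hcoff hc1' hc2', linkRow_hcp_m_1 y' hy' t₁ ht₁' t₂ ht₂' _ hcP' h12 hhex' hcoff hc1' hc2', linkRow_hcp_m_2 y' hy' t₁ ht₁' t₂ ht₂' _ hcP' h12 hhex' hcoff hc1' hc2', linkRow_hcp_m_3 y' hy' t₁ ht₁' t₂ ht₂' _ hcP' h12 hhex' hcoff hc1' hc2', linkRow_hcp_m_4 y' hy' t₁ ht₁' t₂ ht₂' _ hcP' h12 hhex' hcoff hc1' hc2', linkRow_hcp_m_5 y' hy' t₁ ht₁' t₂ ht₂' _ hcP'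 h12 hhex' hcoff hc1' hc2', linkRow_hcp_m_6 y' hy' t₁ ht₁' t₂ ht₂' _ hcP' h12 hhex' hcoff hc1' hc2', linkRow_hcp_m_7 y' hy' t₁ ht₁' t₂ ht₂' _ hcP' h12 hhex' hcoff hc1' hc2', linkRow_hcp_m_8 y' hy' t₁ ht₁' t₂ ht₂' _ hcP' h12 hhex' hcoff hc1' hc2', linkRow_hcp_m_9 y' hy' t₁ ht₁' t₂ ht₂' _ hcP' h12 hhex' hcoff hc1' hc2', linkRow_hcp_m_10 y' hy' t₁ ht₁' t₂ ht₂' _ hcP' h12 hhex' hcoff hc1' hc2', linkRow_hcp_m_11 y' hy' t₁ ht₁' t₂ ht₂' _ hcP' h12 hhex' hcoff hc1' hc2']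

end Summit.AtomisticToContinuum.Crystallization.Theorems.PalmUnimodularRigidityShellsToBarlowChart.Clean

end
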